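import Summits.QuantumFields.YangMills.Theorems.DiagonalMirrorRPRWilsonDiagonalModelInsertion
import Summits.QuantumFields.YangMills.Theorems.DiagonalMirrorRPRFamObsGrowth

/-!
# Crux `WeakCouplingHypercubicLimitRP` (stmt-QuantumFields-27398) / aside `DiagonalMirrorRPR` (stmt-QuantumFields-10604), door B,
# construction F1_diag — PAIRING LAYER, step P2′: unrolling the cyclic `K_u`-chain at the insertion window (block × free chain)

Helper file (`--supports stmt-QuantumFields-27398 --as helper`) of the hand `hand-10604-wilsonDiagModel-2` (docket director-ym g23, O4 WORD
18 (3)(iii) / 20 (1); between steps P2 and P3 of hand-1's ROADMAP-F1diag v4 §1⅞) for the registered stub D1 `stub_diagRPOfPlaneLimits` of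
`Cruxes/WeakCouplingHypercubicLimitRP/Lines/Sketch.lean` (sha16 `7bf38c709623ad77`); it closes nothing by itself.

WHAT (finite bookkeeping on `ℤ/mℤ`, then the chain).
* §1 `prod_univ_zmod_eq_prod_Ico`: a product over `ℤ/mℤ` is the product over ANY integer window of length `m`,
  `∏_{t : ℤ/mℤ} f t = ∏_{i ∈ [lo, lo + m)} f i`; `prod_univ_zmod_split`: hence it splits as (window `[lo, hi]`) × (the rest `[hi + 1, lo + m)`)
  whenever `lo ≤ hi + 1 ≤ lo + m`.
* §2 **`prod_stepKernelU_split`** / **`gramPairing_mul_diagCyclicTraceU_eq_split`** (P2′): once `2d + 2 ≤ S_k`, the cyclic product of two-step kernels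
  `∏_{t ∈ ℤ/S_kℤ} K_u(Z_t, Z_{t+1})` is the BLOCK product over the bonds `t ∈ [−d−1, d]` (the `2d + 2` steps touching the layers `−d−1, …, d+1` that
  carry the two insertions of P1/P1′/P2 and their two boundary steps) times the FREE product over `t ∈ [d+1, S_k−d−1)` (`S_k − 2d − 2` steps), and the
  insertion form of P2 (`gramPairing_mul_diagCyclicTraceU_eq`, ✓p828057) is rewritten accordingly.  This is the shape in which the sandwich step P3
  reads the integrand: «(block kernel between the boundary states at layers `−d−1` and `d+1`) × (free `K_u`-chain of length `S_k − 2d − 2`)», to be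
  matched with `Literature/Analysis/OperatorTheory/HermitianKernelSandwichedTrace.hasSum_pow_inner_sandwich` (one `kS`-bond + `M + 2` kernel bonds,
  `M + 2 = S_k − 2d − 2`) after hand-1's feature lift / reweighting (`…Reweight`, `…SpectralData.exists_eigenPackage`).

HONEST FRAMING: bookkeeping only; `wilsonDiagonalModel` is NOT landed (P3 sandwich/positivity, P4, assembly remain); no letter is proved; D1, ⟨27398⟩,
S6i and the aside ⟨10604⟩ are OPEN; nothing here bears on the summit; the Yang–Mills mass gap is NOT proved here or anywhere in the tree.  No definition,
no instance, no notation, `autoImplicit false`.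

References: K. Osterwalder, E. Seiler, Ann. Phys. 110 (1978) §2–3; E. Seiler, LNP 159 (1982) Ch. 2.
-/

set_option autoImplicit false

noncomputable section

open scoped BigOperators
open MeasureTheory Filter Topology
open Literature.MathematicalPhysics.QuantumLattice Literature.MathematicalPhysics.AQFT
  Literature.MathematicalPhysics.QuantumFieldTheory

namespace Summit.QuantumFields.YangMills.Cruxes.DiagonalMirrorRPR.SignTwistedDiagonalTrace.WilsonDiagonal

/-! ## §1 Products over `ℤ/mℤ` as products over integer windows -/

section ZModWindow

variable {M : Type*} [CommMonoid M] {m : ℕ} [NeZero m]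

omit [NeZero m] in
/-- Two integers of the same residue mod `m` at distance `< m` are equal. -/
theorem int_eq_of_cast_zmod_eq {i j : ℤ} (h : (i : ZMod m) = (j : ZMod m)) (hij : |i - j| < m) : i = j := by
  have hdvd : (m : ℤ) ∣ i - j := (ZMod.intCast_eq_intCast_iff_dvd_sub j i m).1 h.symm
  have h0 : i - j = 0 := Int.eq_zero_of_abs_lt_dvd hdvd hij
  omega

/-- **A product over `ℤ/mℤ` is the product over any integer window of length `m`.** -/
theorem prod_univ_zmod_eq_prod_Ico (f : ZMod m → M) (lo : ℤ) :
    ∏ t : ZMod m, f t = ∏ i ∈ Finset.Ico lo (lo + m), f (i : ZMod m) := by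
  have hm : 0 < m := Nat.pos_of_ne_zero (NeZero.ne m)
  symm
  refine Finset.prod_nbij (fun i : ℤ => (i : ZMod m)) (fun _ _ => Finset.mem_univ _) ?_ ?_ (fun _ _ => rfl)
  · -- injective on the window
    intro i hi j hj hij
    rw [Finset.mem_coe, Finset.mem_Ico] at hi hj
    exact int_eq_of_cast_zmod_eq hij (abs_sub_lt_iff.2 ⟨by omega, by omega⟩)
  · -- surjective onto `ℤ/mℤ`
    intro t _
    refine ⟨lo + ((t - (lo : ZMod m)).val : ℤ), ?_, ?_⟩
    · rw [Finset.mem_coe, Finset.mem_Ico]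
      have hv : ((t - (lo : ZMod m)).val : ℤ) < m := by exact_mod_cast ZMod.val_lt _
      constructor <;> omega
    · show ((lo + ((t - (lo : ZMod m)).val : ℤ) : ℤ) : ZMod m) = t
      rw [Int.cast_add, Int.cast_natCast, ZMod.natCast_zmod_val, add_sub_cancel]

/-- **Window split.**  For `lo ≤ hi + 1 ≤ lo + m`: `∏_{t : ℤ/mℤ} f t = (∏_{i ∈ [lo, hi]} f i) · ∏_{i ∈ [hi+1, lo+m)} f i`. -/
theorem prod_univ_zmod_split (f : ZMod m → M) {lo hi : ℤ} (h1 : lo ≤ hi + 1) (h2 : hi + 1 ≤ lo + m) :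
    ∏ t : ZMod m, f t = (∏ i ∈ Finset.Icc lo hi, f (i : ZMod m)) * ∏ i ∈ Finset.Ico (hi + 1) (lo + m), f (i : ZMod m) := by
  rw [prod_univ_zmod_eq_prod_Ico f lo, ← Finset.Ico_union_Ico_eq_Ico h1 h2,
    Finset.prod_union (Finset.Ico_disjoint_Ico_consecutive lo (hi + 1) (lo + m))]
  congr 1

end ZModWindow

/-! ## §2 P2′: the chain unrolled at the insertion window -/

section Split

variable {S : ℕ} [NeZero S] {G : Type*} [Group G] {Nc : ℕ} (ρ : G →* Matrix (Fin Nc) (Fin Nc) ℂ)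

/-- **The cyclic `K_u`-product unrolled at the window** `[−d−1, d]`: for `2d + 2 ≤ S`,
`∏_{t ∈ ℤ/Sℤ} K_u(Z_t, Z_{t+1}) = (∏_{i=−d−1}^{d} K_u(Z_i, Z_{i+1})) · ∏_{i=d+1}^{S−d−2} K_u(Z_i, Z_{i+1})` — block (the `2d+2` steps across the
layers `−d−1, …, d+1`) times free chain (`S − 2d − 2` steps). -/
theorem prod_stepKernelU_split (β : ℝ) (Z : ZMod S → LayerCfg S S G) {d : ℕ} (hd : 2 * d + 2 ≤ S) :
    ∏ t : ZMod S, stepKernelU ρ β (Z t) (Z (t + 1)) =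
      (∏ i ∈ Finset.Icc (-(d : ℤ) - 1) d, stepKernelU ρ β (Z (i : ZMod S)) (Z ((i : ZMod S) + 1))) *
        ∏ i ∈ Finset.Ico ((d : ℤ) + 1) ((S : ℤ) - d - 1), stepKernelU ρ β (Z (i : ZMod S)) (Z ((i : ZMod S) + 1)) := by
  have h := prod_univ_zmod_split (m := S) (fun t => stepKernelU ρ β (Z t) (Z (t + 1))) (lo := -(d : ℤ) - 1) (hi := d)
    (by omega) (by omega)
  rw [h]
  congr 2
  ring

end Split

section SplitPairing

variable {G : Type} [Group G] [TopologicalSpace G] [IsTopologicalGroup G] [CompactSpace G]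
  [MeasurableSpace G] [BorelSpace G] (r : LatticeRep G) (sch : SpeciesScheme (YMSpecies G))

/-- **P2′ — the insertion form unrolled at the window.**  For a reflected family `F` and a step `k` with `2d + 2 ≤ S_k`:
`gramPairing r sch F k · Tr K_u^{S_k} = ∫ (Y∘P)((assemble Z)~) · Y((assemble Z)~) · [∏_{i=−d−1}^{d} K_u(Z_i,Z_{i+1})] · [∏_{i=d+1}^{S_k−d−2} K_u(Z_i,Z_{i+1})] dZ`.
With `d = d_k` the depth of P1 (`exists_famDepth_layerAssembleU`: the second insertion reads `Z_1 … Z_d`; by `layerReadU_swap_layerAssembleU` the first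
reads `Z_{−d} … Z_0`), the bracketed block and the two insertions involve only the layers `−d−1, …, d+1`, and the free product only `d+1, …, S_k−d−1`. -/
theorem gramPairing_mul_diagCyclicTraceU_eq_split (F : ReflectedFamily) (k : ℕ) {d : ℕ} (hd : 2 * d + 2 ≤ sch.side k) :
    gramPairing r sch F k * diagCyclicTraceU r.ρ (sch.β k) (sch.side k) (S := sch.side k) (G := G) =
      ∫ Z : ZMod (sch.side k) → LayerCfg (sch.side k) (sch.side k) G,
          famObs r sch F k (torusLift (sch.side k) (configPerm (Equiv.swap (0 : Fin 4) 1) (layerAssembleU Z))) *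
              famObs r sch F k (torusLift (sch.side k) (layerAssembleU Z)) *
            ((∏ i ∈ Finset.Icc (-(d : ℤ) - 1) d,
                stepKernelU r.ρ (sch.β k) (Z (i : ZMod (sch.side k))) (Z ((i : ZMod (sch.side k)) + 1))) *
              ∏ i ∈ Finset.Ico ((d : ℤ) + 1) ((sch.side k : ℤ) - d - 1),
                stepKernelU r.ρ (sch.β k) (Z (i : ZMod (sch.side k))) (Z ((i : ZMod (sch.side k)) + 1)))
          ∂(Measure.pi fun _ => layerHaar (sch.side k) (sch.side k) G) := by
  rw [gramPairing_mul_diagCyclicTraceU_eq]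
  refine integral_congr_ae (Eventually.of_forall fun Z => ?_)
  dsimp only
  rw [prod_stepKernelU_split r.ρ (sch.β k) Z hd]

omit [TopologicalSpace G] [IsTopologicalGroup G] [CompactSpace G] [BorelSpace G] in
/-- `2 d_k + 2 ≤ S_k` eventually, for any depth sequence with `a_k d_k` bounded (e.g. the depth of P1): the window fits. -/
theorem eventually_two_mul_add_two_le_side {d : ℕ → ℕ} (hd : ∃ R' : ℝ, ∀ᶠ k in atTop, sch.a k * d k ≤ R') :
    ∀ᶠ k in atTop, 2 * d k + 2 ≤ sch.side k := by
  obtain ⟨R', hR'⟩ := hd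
  have hx : Tendsto (fun k => sch.a k * (sch.side k : ℝ)) atTop atTop := tendsto_a_mul_side' sch
  have ha1 : ∀ᶠ k in atTop, sch.a k ≤ 1 :=
    ((tendsto_order.1 sch.tendsto_a).2 1 one_pos).mono fun k hk => hk.le
  filter_upwards [hR', ha1, hx.eventually_gt_atTop (2 * R' + 2)] with k hk ha1k hbig
  have ha := sch.a_pos k
  have h1 : sch.a k * ((2 * d k + 2 : ℕ) : ℝ) ≤ 2 * R' + 2 := by
    push_cast
    nlinarith
  have h2 : sch.a k * ((2 * d k + 2 : ℕ) : ℝ) < sch.a k * (sch.side k : ℝ) := lt_of_le_of_lt h1 hbig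
  exact_mod_cast (lt_of_mul_lt_mul_left h2 ha.le).le

end SplitPairing

end Summit.QuantumFields.YangMills.Cruxes.DiagonalMirrorRPR.SignTwistedDiagonalTrace.WilsonDiagonal

end
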